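import Literature.Topology.FourManifolds.TrisectionFunctorSPC4Proofs
import Literature.Topology.FourManifolds.TrisectionsProofs
import HarnessLib

/-!
# Abrams–Gay–Kirby, Cor. 6 (SPC4 ⟺ every `(3k, k)`-trisection of `{1}` is stably trivial) from its FOUR remaining named leaves

Topic `Literature/Topology/FourManifolds`. Companion (one theorem; no definition, no named fact, no
`sorry`) of `TrisectionFunctor.lean` (the named fact (f) `spc4_iff_forall_isStablyTrivial`,
Abrams–Gay–Kirby 2018, Cor. 6), `TrisectionFunctorSPC4.lean` and `TrisectionFunctorSPC4Proofs.lean`,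
which PROVE Cor. 6 at every universe from five named leaves
(`spc4_iff_forall_isStablyTrivial_of_five_leaves`: Gay–Kirby Thm. 4 `exists_isBalancedGKTrisection`
and the parts (b′) `diffeomorph_of_iso_groupGKTrisectionOf`, (c′) `exists_stabilized_gkTrisection`,
(e′) `exists_gkTrisected_of_isGroupTrisection` of AGK Thm. 5 with (i)
`stablyIso_groupGKTrisectionOf_of_diffeomorphic` = Thm. 5 with Gay–Kirby Thm. 11).

Fact-decomposition record (librarian, fact-decompose, 2026-08-16; the fact ran to the prover budget
cap as an XL fact): Gay–Kirby's existence theorem is by now DISCHARGED in the tree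
(`exists_isBalancedGKTrisection_holds`, `TrisectionsProofs.lean`: the `(g; k₁, k₂, k₁)`-trisection of
`exists_isGKTrisection` balanced by implants), so the residual trust base of
`spc4_iff_forall_isStablyTrivial_holds` is exactly the FOUR existing named facts (b′), (c′), (e′), (i)
of `TrisectionFunctorGK.lean` / `TrisectionFunctorSPC4.lean` — (c′) being itself assembled from its
two printed halves in `TrisectionFunctorGKStabilizationSplit.lean`
(`exists_stabilized_gkTrisection_holds_of`: geometric stabilisation for one marking + Nielsen's
theorem). The theorem `spc4_iff_forall_isStablyTrivial_holds_of` records this in the canonical shape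
`Child₁ → … → Child₄ → Parent`; no new named fact is introduced.

## References

* [AbramsGayKirby2018] A. Abrams, D. Gay, R. Kirby, *Group trisections and smooth 4-manifolds*,
  Geom. Topol. 22 (2018) 1537–1545: Thm. 5 and Cor. 6 (p. 1541), proof of Thm. 5 (p. 1542).
* [GayKirby2016] D. Gay, R. Kirby, *Trisecting 4-manifolds*, Geom. Topol. 20 (2016) 3097–3132:
  Thm. 4, Def. 8, Lemma 10, Thm. 11.
-/

noncomputable section

namespace Literature.Topology.FourManifolds

universe u

/-- **Abrams–Gay–Kirby 2018, Cor. 6 (`spc4_iff_forall_isStablyTrivial`, every universe) from its four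
remaining named leaves** (fact-decomposition glue, canonical name): (b′) rigidity
`diffeomorph_of_iso_groupGKTrisectionOf` (`ℳ ∘ 𝒢 = id` up to diffeomorphism), (c′) stabilisation
compatibility `exists_stabilized_gkTrisection`, (e′) surjectivity `exists_gkTrisected_of_isGroupTrisection`
(the map `ℳ`), and (i) `stablyIso_groupGKTrisectionOf_of_diffeomorphic` (Thm. 5 with Gay–Kirby
Thm. 11); Gay–Kirby's existence theorem Thm. 4 is supplied by its discharge
`exists_isBalancedGKTrisection_holds`. This is `spc4_iff_forall_isStablyTrivial_of_five_leaves`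
(`TrisectionFunctorSPC4Proofs.lean`) so fed. [cite: AbramsGayKirby2018, Cor. 6 and Thm. 5 (p. 1541)]
[cite: GayKirby2016, Thm. 4 and Thm. 11] -/
theorem spc4_iff_forall_isStablyTrivial_holds_of
    (hb : diffeomorph_of_iso_groupGKTrisectionOf.{0})
    (hc : exists_stabilized_gkTrisection.{0})
    (he : exists_gkTrisected_of_isGroupTrisection.{0})
    (hi : stablyIso_groupGKTrisectionOf_of_diffeomorphic.{0}) :
    spc4_iff_forall_isStablyTrivial.{u} :=
  spc4_iff_forall_isStablyTrivial_of_five_leaves exists_isBalancedGKTrisection_holds.{0} hb hc he hi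

end Literature.Topology.FourManifolds

end
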